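import Mathlib
import HarnessLib
import Summits.Ventures.LatticeQCDFlow.Exactness.GaugeFTHMCLeapfrog
import Summits.Ventures.LatticeQCDFlow.Exactness.SphereKickJacobian
import Literature.Probability.MarkovChains.HMCExpDeltaH

/-!
# The acceptance gate `⟨e^{−ΔH}⟩ = 1` of field-transformed HMC is an identity of the exact kernel

Row 14 of the engine table accepts the learned-map-inside-HMC engine (family B; zero-parameter
member = the masked LO Wilson-flow map typed in `U1WilsonFlowLO*.lean` / `SU2WilsonFlowLO*.lean`)
on the numerical test `⟨e^{−ΔH}⟩ = 1 within 2σ over 10⁴ trajectories`.  This file records, def-free,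
that the tested quantity is EXACTLY `1` for the kernel the engine runs, started in equilibrium —
so the test is a check of the implementation (reversibility, Jacobian bookkeeping, integrator
symmetry), not of an approximation.

Setting (`GaugeFTHMCLeapfrog.lean`): links `Q` (a measurable group, left-invariant reference
measure `μ`), momenta `P` (reflection- and translation-invariant `ν`), field transformation `F`
with Jacobian `J > 0` certified by `HasJacobian μ F (ofReal ∘ J)`, pulled-back Hamiltonian
`H̃(V, π) = S (F V) − log J V + T π`, proposal `Ψ = flip ∘ leapfrog (mulDrift e) g ^ n` (any
measurable drift `e` with `e(−p) = e(p)⁻¹`, ANY measurable force `g`, any length `n`).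

* `exp_neg_ftHamiltonian` — `e^{−H̃} = e^{−(S∘F + T)} · J` pointwise.
* `lintegral_exp_neg_ftHamiltonian`, `fthmc_partitionFn_eq` — **the extended partition function
  is transformation-independent**: `∫ e^{−H̃} d(μ ⊗ ν) = ∫ e^{−(S + T)} d(μ ⊗ ν)` (change of
  variables through the certified Jacobian, `HasJacobian.lintegral_comp_mul`, and Tonelli).
* `partitionFn_prod_pos` — `0 < ∫ e^{−(S+T)}` as soon as `e^{−S}` and `e^{−T}` are integrable on
  non-zero measures (it factorises).
* `gauge_fthmc_leapfrog_creutz` — **Creutz's identity for FT-HMC**: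
  `∫ e^{−(H̃(Ψ z) − H̃ z)} d Boltzmann_{H̃}(z) = 1`, from the Literature fact
  `HMC.integral_exp_neg_deltaH` [MontvayMunster1994 §7.6] applied to the measure-preserving
  proposal (`measurePreserving_gaugeLeapfrogProposal`); the only size hypothesis is on the PLAIN
  partition function `∫ e^{−(S+T)}`, by the previous item.
* `gauge_fthmc_leapfrog_gaussian_creutz` — the engine's rungs: `μ` a left-invariant probability
  measure (product Haar), momenta `κ → ℝ` with Lebesgue measure and `T = Σ p²/2`
  (`integrable_exp_neg_piGaussianKinetic`), `e^{−S}` integrable: `⟨e^{−ΔH̃}⟩ = 1` with no further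
  hypothesis; `u1_fthmc_leapfrog_gaussian_creutz` is the U(1) rung verbatim (links `ι → U(1)`,
  drift `e^{i c p}`) — combine with `exists_measurableEquiv_u1WilsonFlowLOSubstep` /
  `exists_layers_u1WilsonFlowLO` (and the SU(2) analogues) for the zero-parameter member.

NOT CLAIMED: anything about the chain started OUT of equilibrium (the test's burn-in), the `2σ`
error model (autocorrelations), floating point, or any number; `⟨ΔH̃⟩ ≥ 0` is the Literature fact
`HMC.integral_deltaH_nonneg` and is not restated.

HONEST FRAMING: exact (Metropolis-corrected) sampling algorithms for lattice gauge theory; figures of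
merit are autocorrelation/cost numbers at stated couplings and volumes; no continuum-physics claim.
-/

namespace Summit.Ventures.LatticeQCDFlow.Exactness

open Set Function MeasureTheory
open Literature.Probability.MarkovChains.HMC (partitionFn boltzmann integral_exp_neg_deltaH)
open Literature.MathematicalPhysics.QuantumFieldTheory (haarProbability)
open scoped ENNReal

section General

variable {Q P : Type*} [MeasurableSpace Q] [MeasurableSpace P]

omit [MeasurableSpace Q] [MeasurableSpace P] in
/-- Pointwise: `e^{−((S (F v) − log J v) + T p)} = e^{−(S (F v) + T p)} · J v` for `J v > 0`. -/
theorem exp_neg_ftHamiltonian {S : Q → ℝ} {T : P → ℝ} {F : Q → Q} {J : Q → ℝ}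
    (hJ : ∀ v, 0 < J v) (v : Q) (p : P) :
    Real.exp (-((S (F v) - Real.log (J v)) + T p)) = Real.exp (-(S (F v) + T p)) * J v := by
  rw [show -((S (F v) - Real.log (J v)) + T p) = -(S (F v) + T p) + Real.log (J v) by ring,
    Real.exp_add, Real.exp_log (hJ v)]

/-- The pulled-back Hamiltonian `H̃ (v, p) = (S (F v) − log J v) + T p` is measurable. -/
theorem measurable_ftHamiltonian {S : Q → ℝ} (hS : Measurable S) {T : P → ℝ} (hT : Measurable T)
    {F : Q → Q} (hFm : Measurable F) {J : Q → ℝ} (hJm : Measurable J) :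
    Measurable fun z : Q × P => (S (F z.1) - Real.log (J z.1)) + T z.2 :=
  (((hS.comp hFm).comp measurable_fst).sub
    (Real.measurable_log.comp (hJm.comp measurable_fst))).add (hT.comp measurable_snd)

/-- **The extended partition function is transformation-independent (Lebesgue-integral form).**
For `F` with certified Jacobian `J > 0` w.r.t. `μ`:
`∫⁻ e^{−H̃} d(μ ⊗ ν) = ∫⁻ e^{−(S + T)} d(μ ⊗ ν)` — Tonelli, then the change of variables
`∫⁻ q(F v) J(v) dμ = ∫⁻ q dμ` (`HasJacobian.lintegral_comp_mul`) in the link variable. -/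
theorem lintegral_exp_neg_ftHamiltonian {μ : Measure Q} [SFinite μ] {ν : Measure P} [SFinite ν]
    {F : Q → Q} {J : Q → ℝ} (hJ : ∀ v, 0 < J v) (hJm : Measurable J)
    (hF : HasJacobian μ F fun v => ENNReal.ofReal (J v))
    {S : Q → ℝ} (hS : Measurable S) {T : P → ℝ} (hT : Measurable T) :
    ∫⁻ z, ENNReal.ofReal (Real.exp (-((S (F z.1) - Real.log (J z.1)) + T z.2))) ∂(μ.prod ν) =
      ∫⁻ z, ENNReal.ofReal (Real.exp (-(S z.1 + T z.2))) ∂(μ.prod ν) := by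
  have hL : Measurable fun z : Q × P =>
      ENNReal.ofReal (Real.exp (-((S (F z.1) - Real.log (J z.1)) + T z.2))) :=
    (Real.measurable_exp.comp (measurable_ftHamiltonian hS hT hF.measurable hJm).neg).ennreal_ofReal
  have hR : Measurable fun z : Q × P => ENNReal.ofReal (Real.exp (-(S z.1 + T z.2))) :=
    (Real.measurable_exp.comp
      ((hS.comp measurable_fst).add (hT.comp measurable_snd)).neg).ennreal_ofReal
  rw [lintegral_prod_symm' _ hL, lintegral_prod_symm' _ hR]
  refine lintegral_congr fun p => ?_
  have hq : Measurable fun v : Q => ENNReal.ofReal (Real.exp (-(S v + T p))) :=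
    (Real.measurable_exp.comp (hS.add measurable_const).neg).ennreal_ofReal
  rw [hF.lintegral_comp_mul hq]
  refine lintegral_congr fun v => ?_
  simp only
  rw [exp_neg_ftHamiltonian hJ v p, ENNReal.ofReal_mul (Real.exp_pos _).le]

/-- **The extended partition function is transformation-independent**:
`Z̃ = ∫ e^{−H̃} d(μ ⊗ ν) = ∫ e^{−(S+T)} d(μ ⊗ ν) = Z` for every certified `(F, J)`. -/
theorem fthmc_partitionFn_eq {μ : Measure Q} [SFinite μ] {ν : Measure P} [SFinite ν]
    {F : Q → Q} {J : Q → ℝ} (hJ : ∀ v, 0 < J v) (hJm : Measurable J)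
    (hF : HasJacobian μ F fun v => ENNReal.ofReal (J v))
    {S : Q → ℝ} (hS : Measurable S) {T : P → ℝ} (hT : Measurable T) :
    partitionFn (μ.prod ν) (fun z : Q × P => (S (F z.1) - Real.log (J z.1)) + T z.2) =
      partitionFn (μ.prod ν) (fun z : Q × P => S z.1 + T z.2) := by
  simp only [partitionFn]
  have hLm : Measurable fun z : Q × P => Real.exp (-((S (F z.1) - Real.log (J z.1)) + T z.2)) :=
    Real.measurable_exp.comp (measurable_ftHamiltonian hS hT hF.measurable hJm).neg
  have hRm : Measurable fun z : Q × P => Real.exp (-(S z.1 + T z.2)) :=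
    Real.measurable_exp.comp ((hS.comp measurable_fst).add (hT.comp measurable_snd)).neg
  rw [integral_eq_lintegral_of_nonneg_ae
      (f := (fun z : Q × P => Real.exp (-((S (F z.1) - Real.log (J z.1)) + T z.2))))
      (ae_of_all _ fun z => (Real.exp_pos _).le) hLm.aestronglyMeasurable,
    integral_eq_lintegral_of_nonneg_ae (f := (fun z : Q × P => Real.exp (-(S z.1 + T z.2))))
      (ae_of_all _ fun z => (Real.exp_pos _).le) hRm.aestronglyMeasurable,
    lintegral_exp_neg_ftHamiltonian hJ hJm hF hS hT]

/-- **The plain extended partition function is positive** as soon as `e^{−S}` is `μ`-integrable,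
`e^{−T}` is `ν`-integrable and neither measure is zero: it factorises as
`(∫ e^{−S} dμ) · (∫ e^{−T} dν)`. -/
theorem partitionFn_prod_pos {μ : Measure Q} [SFinite μ] [NeZero μ] {ν : Measure P} [SFinite ν]
    [NeZero ν] {S : Q → ℝ} {T : P → ℝ} (hSi : Integrable (fun v => Real.exp (-S v)) μ)
    (hTi : Integrable (fun p => Real.exp (-T p)) ν) :
    0 < partitionFn (μ.prod ν) fun z : Q × P => S z.1 + T z.2 := by
  simp only [partitionFn]
  have h1 : (fun z : Q × P => Real.exp (-(S z.1 + T z.2))) =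
      fun z => Real.exp (-S z.1) * Real.exp (-T z.2) := by
    funext z
    rw [neg_add, Real.exp_add]
  rw [h1, integral_prod_mul (fun v => Real.exp (-S v)) (fun p => Real.exp (-T p))]
  exact mul_pos (integral_exp_pos hSi) (integral_exp_pos hTi)

/-- **Creutz's identity for field-transformed gauge HMC as the engine runs it.**  Links in a
measurable group `Q` with left-invariant s-finite `μ`, momenta in `P` with reflection- and
translation-invariant s-finite `ν`; a field transformation `F` with Jacobian `J > 0` certified by
`HasJacobian`; drift `e` (measurable), ANY measurable force `g`, any trajectory length `n`;
measurable action `S` and kinetic term `T` with `0 < ∫ e^{−(S+T)} d(μ ⊗ ν)`.  Then for the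
proposal `Ψ = flip ∘ leapfrog^n` and the pulled-back Hamiltonian `H̃ = S∘F − log J + T`,
started from the `H̃`-Boltzmann law (equilibrium of the FT-HMC chain in the `V`-frame),
`𝔼 [e^{−(H̃(Ψ z) − H̃ z)}] = 1` EXACTLY. -/
theorem gauge_fthmc_leapfrog_creutz [Group Q] [MeasurableMul₂ Q] {μ : Measure Q}
    [μ.IsMulLeftInvariant] [SFinite μ] [AddCommGroup P] [MeasurableNeg P] [MeasurableAdd₂ P]
    {ν : Measure P} [ν.IsNegInvariant] [ν.IsAddRightInvariant] [SFinite ν]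
    {F : Q → Q} {J : Q → ℝ} (hJ : ∀ v, 0 < J v) (hJm : Measurable J)
    (hF : HasJacobian μ F fun v => ENNReal.ofReal (J v))
    {e : P → Q} (hem : Measurable e) {g : Q → P} (hg : Measurable g) (n : ℕ)
    {S : Q → ℝ} (hS : Measurable S) {T : P → ℝ} (hT : Measurable T)
    (hZ : 0 < partitionFn (μ.prod ν) fun z : Q × P => S z.1 + T z.2) :
    ∫ z, Real.exp (-(((S (F (((flip : Equiv.Perm (Q × P)) * leapfrog (mulDrift e) g ^ n) z).1) -
            Real.log (J (((flip : Equiv.Perm (Q × P)) * leapfrog (mulDrift e) g ^ n) z).1)) +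
            T (((flip : Equiv.Perm (Q × P)) * leapfrog (mulDrift e) g ^ n) z).2) -
          ((S (F z.1) - Real.log (J z.1)) + T z.2)))
      ∂(boltzmann (μ.prod ν) fun z : Q × P => (S (F z.1) - Real.log (J z.1)) + T z.2) = 1 := by
  have hZ' : 0 < partitionFn (μ.prod ν)
      (fun z : Q × P => (S (F z.1) - Real.log (J z.1)) + T z.2) := by
    rw [fthmc_partitionFn_eq hJ hJm hF hS hT]
    exact hZ
  exact integral_exp_neg_deltaH (H := fun z : Q × P => (S (F z.1) - Real.log (J z.1)) + T z.2)
    (measurePreserving_gaugeLeapfrogProposal hem hg n)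
    (measurable_ftHamiltonian hS hT hF.measurable hJm) hZ'

end General

/-! ## The engine's rungs: probability Haar links, Lebesgue momenta, Gaussian kinetic term -/

section Gaussian

variable {Q : Type*} [MeasurableSpace Q] {κ : Type*} [Fintype κ]

omit [MeasurableSpace Q] in
/-- The Gaussian momentum weight `e^{−Σ_i p_i²/2}` is Lebesgue-integrable on `ℝ^κ`
(a finite product of one-dimensional Gaussians). -/
theorem integrable_exp_neg_piGaussianKinetic :
    Integrable (fun p : κ → ℝ => Real.exp (-(∑ i, p i ^ 2 / 2))) := by
  have h1 : (fun p : κ → ℝ => Real.exp (-(∑ i, p i ^ 2 / 2))) =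
      fun p => ∏ i, Real.exp (-(2 : ℝ)⁻¹ * p i ^ 2) := by
    funext p
    rw [← Real.exp_sum, ← Finset.sum_neg_distrib]
    congr 1
    exact Finset.sum_congr rfl fun i _ => by ring
  rw [h1, volume_pi]
  exact Integrable.fintype_prod (f := fun (_ : κ) (x : ℝ) => Real.exp (-(2 : ℝ)⁻¹ * x ^ 2))
    fun _ => integrable_exp_neg_mul_sq (by norm_num)

omit [MeasurableSpace Q] in
/-- Lebesgue measure on `ℝ^κ` is not the zero measure. -/
theorem neZero_volume_pi : NeZero (volume : Measure (κ → ℝ)) := by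
  refine ⟨fun h => ?_⟩
  have h1 := (piGaussianWeight_univ_ne_zero_ne_top (ι := κ)).1
  rw [h, withDensity_zero_left] at h1
  exact h1 rfl

/-- **Creutz's identity on the engine's rungs.**  Links in a measurable group `Q` carrying a
left-invariant PROBABILITY measure `μ` (product Haar), momenta `κ → ℝ` with Lebesgue measure and
the Gaussian kinetic term `T = Σ_i p_i²/2`, any measurable drift `e`, ANY measurable force `g`, any
`n`, a measurable action with `e^{−S}` integrable (e.g. `S` bounded below), and ANY field
transformation `F` with certified Jacobian `J > 0`: in equilibrium `⟨e^{−ΔH̃}⟩ = 1` exactly. -/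
theorem gauge_fthmc_leapfrog_gaussian_creutz [Group Q] [MeasurableMul₂ Q] {μ : Measure Q}
    [μ.IsMulLeftInvariant] [IsProbabilityMeasure μ]
    {F : Q → Q} {J : Q → ℝ} (hJ : ∀ v, 0 < J v) (hJm : Measurable J)
    (hF : HasJacobian μ F fun v => ENNReal.ofReal (J v))
    {e : (κ → ℝ) → Q} (hem : Measurable e) {g : Q → (κ → ℝ)} (hg : Measurable g) (n : ℕ)
    {S : Q → ℝ} (hS : Measurable S) (hSi : Integrable (fun v => Real.exp (-S v)) μ) :
    ∫ z, Real.exp (-(((S (F (((flip : Equiv.Perm (Q × (κ → ℝ))) *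
              leapfrog (mulDrift e) g ^ n) z).1) -
            Real.log (J (((flip : Equiv.Perm (Q × (κ → ℝ))) * leapfrog (mulDrift e) g ^ n) z).1)) +
            ∑ i, (((flip : Equiv.Perm (Q × (κ → ℝ))) * leapfrog (mulDrift e) g ^ n) z).2 i ^ 2 / 2) -
          ((S (F z.1) - Real.log (J z.1)) + ∑ i, z.2 i ^ 2 / 2)))
      ∂(boltzmann (μ.prod (volume : Measure (κ → ℝ)))
          fun z : Q × (κ → ℝ) => (S (F z.1) - Real.log (J z.1)) + ∑ i, z.2 i ^ 2 / 2) = 1 := by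
  haveI := isNegInvariant_volume_pi (Λ := κ)
  haveI := neZero_volume_pi (κ := κ)
  have h := gauge_fthmc_leapfrog_creutz (ν := (volume : Measure (κ → ℝ)))
    (T := fun p : κ → ℝ => ∑ i, p i ^ 2 / 2) hJ hJm hF hem hg n hS measurable_piGaussianKinetic
    (partitionFn_prod_pos hSi integrable_exp_neg_piGaussianKinetic)
  exact h

end Gaussian

/-! ## The U(1) rung verbatim -/

section U1

variable {ι : Type*} [Fintype ι]

/-- **Creutz's identity for FT-HMC on the U(1) rung as `latflow` runs it**: links `ι → U(1)` with
product Haar probability, momenta `ι → ℝ` Lebesgue with `T = Σ p²/2`, drift `V_i ← e^{i c p_i} V_i`,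
ANY measurable force, any `n`, any measurable action (`e^{−S}` is integrable against a probability
measure as soon as `S` is bounded below — here taken as the hypothesis `hSi`), and ANY certified
layer `(F, J)` — in particular the masked LO Wilson-flow sub-steps and schedules of
`U1WilsonFlowLOSubstep.lean` (`exists_measurableEquiv_u1WilsonFlowLOSubstep`,
`exists_layers_u1WilsonFlowLO`): `⟨e^{−ΔH̃}⟩ = 1` exactly in equilibrium. -/
theorem u1_fthmc_leapfrog_gaussian_creutz
    {F : (ι → Circle) → (ι → Circle)} {J : (ι → Circle) → ℝ} (hJ : ∀ V, 0 < J V)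
    (hJm : Measurable J)
    (hF : HasJacobian (Measure.pi fun _ : ι => haarProbability Circle) F
      fun V => ENNReal.ofReal (J V))
    {S : (ι → Circle) → ℝ} (hS : Measurable S)
    (hSi : Integrable (fun V => Real.exp (-S V)) (Measure.pi fun _ : ι => haarProbability Circle))
    (c : ℝ) {g : (ι → Circle) → (ι → ℝ)} (hg : Measurable g) (n : ℕ) :
    ∫ z, Real.exp (-(((S (F (((flip : Equiv.Perm ((ι → Circle) × (ι → ℝ))) *
              leapfrog (mulDrift fun p : ι → ℝ => fun i => Circle.exp (c * p i)) g ^ n) z).1) -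
            Real.log (J (((flip : Equiv.Perm ((ι → Circle) × (ι → ℝ))) *
              leapfrog (mulDrift fun p : ι → ℝ => fun i => Circle.exp (c * p i)) g ^ n) z).1)) +
            ∑ i, (((flip : Equiv.Perm ((ι → Circle) × (ι → ℝ))) *
              leapfrog (mulDrift fun p : ι → ℝ => fun i => Circle.exp (c * p i)) g ^ n) z).2 i ^ 2 / 2) -
          ((S (F z.1) - Real.log (J z.1)) + ∑ i, z.2 i ^ 2 / 2)))
      ∂(boltzmann ((Measure.pi fun _ : ι => haarProbability Circle).prod (volume : Measure (ι → ℝ)))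
          fun z : (ι → Circle) × (ι → ℝ) => (S (F z.1) - Real.log (J z.1)) + ∑ i, z.2 i ^ 2 / 2) = 1 :=
  gauge_fthmc_leapfrog_gaussian_creutz hJ hJm hF (measurable_circleDrift c) hg n hS hSi

end U1

end Summit.Ventures.LatticeQCDFlow.Exactness
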